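import Summits.AtomisticToContinuum.FouriersLaw.Theorems.BondHeatUncertaintySubdiffusiveBondHeatHalfOhmicOfConeScaleCorrector

/-!
# The current-corrector grading: `CurrentCorrectorBudget a ⟹ ExponentFloor ((3 − a)/2)` — every rung `F(s)` is fed

Support file for stmt-AtomisticToContinuum-11071 (`BondHeatUncertainty.BoundedResponse`; residual of record 11071 ∧ 9121),
decomposition cell `decomp-a2c`, lens-1 (grading), gen 57 — file (7c) (imports (7b) `…HalfOhmicOfConeScaleCorrector`).

File (7b) fed the single rung `F(1/2)` from crux E1 `ConeScaleCorrector` (`‖u_N‖²_{μ_T} ≤ C N² Z` for the Kubo corrector `u_N` of the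
total current).  The same three-line argument (Green–Kubo in corrector form `Z(N−1)T²D = ⟨u_N, J_tot⟩_{μ_T}`, the `N`-uniform statics
`‖J_tot‖² ≤ C_J N Z`, weighted AM–GM) with the weight `θ = N^{(1−a)/2}` turns a corrector budget of ANY exponent `a`,

  `CurrentCorrectorBudget a : ‖u_N‖²_{μ_T} ≤ C(T)·N^a·Z`   (`a = 2` is LITERALLY `ConeScaleCorrector`: `currentCorrectorBudget_two_iff_coneScaleCorrector`),

into `D ≤ S(T)·N^{(a−1)/2}` (`response_le_rpow_of_currentCorrectorBudget`) and hence into the escape floor of exponent `s = (3 − a)/2`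
(`exponentFloor_of_currentCorrectorBudget`).  This is the CORRECTOR-SIDE CURRENCY of the whole exponent ladder of `EscapeGrading`:

  s = (3 − a)/2:   a = 3 ↔ s = 0 (the phonon corner: `‖u‖² ≳ N³Z` for the harmonic chain by Cauchy–Schwarz from `κ_N ≍ N`, `E_N → 1/8`;
                   so `CCB(a)` is phonon-FALSE for every `a < 3`)  ·  a = 2 ↔ s = 1/2 (E1, stmt-14069)  ·
                   a = 1 ↔ s = 1 (the Ohmic floor = 11071: `boundedResponse_of_currentCorrectorBudget_one`).

Consequences (all seams BY NAME onto tree theorems):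
* `boundedResponse_of_currentCorrectorBudget_one` — `CurrentCorrectorBudget 1 → BoundedResponse` (11071 outright; `a ≤ 1` likewise, `…_of_le_one`);
* `boundedResponse_of_splitLaw_of_currentCorrectorBudget` — `SplitLaw θ → CurrentCorrectorBudget a → BoundedResponse` whenever `θ < (3 − a)/2`
  (`1 ≤ a ≤ 3`): the bigraded pairing «defect exponent θ + corrector exponent a, 2θ + a < 3»;
* `boundedResponse_of_localityPassivityLaw_of_currentCorrectorBudget` — **`LocalityPassivityLaw → CurrentCorrectorBudget a → BoundedResponse` for EVERY
  `a < 3`**: under junction locality + buffer passivity (file (5)) the corrector budget only has to beat the PHONON exponent `a = 3` by any `ε > 0`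
  (E1, `a = 2`, is far more than needed); `…_of_bufferedJunctionLaw_…` likewise;
* `currentCorrectorBudget_mono` (`0 < a ≤ b`), `boundedResponse_of_currentCorrectorBudget_of_bootstrap`.

So the docket line «`F(s)`, `1/2 < s < 1`: UNFED» becomes «`F(s)` FED by `CurrentCorrectorBudget (3 − 2s)` for every `0 < s ≤ 1`» (typed feeder; the
exponent `a = 2` is the staffed item 14069; `a < 2` are stronger unstaffed statements, `2 < a < 3` weaker ones that still close the locality–passivity
node).  One new `def` (`CurrentCorrectorBudget`); nothing here closes an item.  References: Kundu–Dhar–Narayan 2009 (open-chain Green–Kubo); folklore.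
-/

noncomputable section

open MeasureTheory Filter Topology Set
open scoped BigOperators ENNReal

namespace Summit.AtomisticToContinuum.FouriersLaw.Theorems.SubdiffusiveBondHeat

namespace EscapeGrading

open Literature.MathematicalPhysics.KineticTheory.HeatConduction
open Summit.AtomisticToContinuum.FouriersLaw.Theses.BondHeatUncertainty (BoundedResponse)
open Summit.AtomisticToContinuum.FouriersLaw.Theses.OddSectorIrreversibility (ConeScaleCorrector)
open Summit.AtomisticToContinuum.FouriersLaw.Theorems.NonBallistic (mul_le_weighted_amgm exists_totalCurrent_sq_le)

/-- **Graded current-corrector budget `CCB(a)`**: for all parameters and `T > 0` there is `C` with `‖u‖²_{L²(μ_T)} ≤ C·N^a·Z_N(T)` for every `N`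
and every a.e.-limit `u` of the finite-horizon Kubo correctors `∫₀^τ P_t J_tot dt` (`μ_T = e^{−H/T}dx`, un-normalised).  Literally
`OddSectorIrreversibility.ConeScaleCorrector` with `N²` replaced by the real power `N^a` (`a = 2` ⟺ E1).  UNDECIDED for `a < 3`
(phonon-false there: harmonic `‖u‖² ≳ N³Z`). [piece · rung] -/
def CurrentCorrectorBudget (a : ℝ) : Prop :=
  ∀ ω₂ lam β γ : ℝ, 0 < ω₂ → 0 < lam → 0 < β → 0 < γ → ∀ T : ℝ, 0 < T → ∃ C : ℝ,
    ∀ (N : ℕ) (u : PhaseSpace N → ℝ),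
      (∀ᵐ x ∂(volume.withDensity fun x : PhaseSpace N =>
          ENNReal.ofReal (Real.exp (-((pinnedChain ω₂ lam β γ).hamiltonian N x) / T))),
        Tendsto (fun τ : ℝ => ∫ t in Ioc (0 : ℝ) τ,
          (∫ y, (∑ i : Fin N, (pinnedChain ω₂ lam β γ).bondCurrent N i y)
            ∂((pinnedChain ω₂ lam β γ).transitionKernel N T T t.toNNReal x))) atTop (𝓝 (u x))) →
      MemLp u 2 (volume.withDensity fun x : PhaseSpace N =>
          ENNReal.ofReal (Real.exp (-((pinnedChain ω₂ lam β γ).hamiltonian N x) / T))) ∧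
        ∫ x, (u x) ^ 2 ∂(volume.withDensity fun x : PhaseSpace N =>
            ENNReal.ofReal (Real.exp (-((pinnedChain ω₂ lam β γ).hamiltonian N x) / T))) ≤
          C * (N : ℝ) ^ a * ∫ x : PhaseSpace N, Real.exp (-((pinnedChain ω₂ lam β γ).hamiltonian N x) / T)

/-- `CCB(2)` is literally E1. [frame] -/
theorem currentCorrectorBudget_two_iff_coneScaleCorrector : CurrentCorrectorBudget 2 ↔ ConeScaleCorrector := by
  simp only [CurrentCorrectorBudget, ConeScaleCorrector, Real.rpow_two]

/-- E1 ⟹ `CCB(2)`. [frame] -/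
theorem currentCorrectorBudget_two_of_coneScaleCorrector (h : ConeScaleCorrector) : CurrentCorrectorBudget 2 :=
  currentCorrectorBudget_two_iff_coneScaleCorrector.2 h

/-- Monotonicity in the exponent: `CCB(a) ⟹ CCB(b)` for `0 < a ≤ b` (`N^a ≤ N^b` for `N ≥ 1`; both vanish at `N = 0`). [frame] -/
theorem currentCorrectorBudget_mono {a b : ℝ} (ha : 0 < a) (hab : a ≤ b) :
    CurrentCorrectorBudget a → CurrentCorrectorBudget b := by
  intro h ω₂ lam β γ hω hl hβ hγ T hT
  obtain ⟨C, hC⟩ := h ω₂ lam β γ hω hl hβ hγ T hT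
  refine ⟨max C 0, fun N u hu => ?_⟩
  obtain ⟨hmem, hle⟩ := hC N u hu
  refine ⟨hmem, hle.trans ?_⟩
  have hZ : 0 ≤ ∫ x : PhaseSpace N, Real.exp (-((pinnedChain ω₂ lam β γ).hamiltonian N x) / T) :=
    integral_nonneg fun _ => (Real.exp_pos _).le
  have hNa : 0 ≤ (N : ℝ) ^ a := Real.rpow_nonneg (Nat.cast_nonneg N) a
  have hNab : (N : ℝ) ^ a ≤ (N : ℝ) ^ b := by
    rcases Nat.eq_zero_or_pos N with rfl | hN
    · simp [Real.zero_rpow ha.ne', Real.zero_rpow (lt_of_lt_of_le ha hab).ne']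
    · exact Real.rpow_le_rpow_of_exponent_le (by exact_mod_cast hN) hab
  calc C * (N : ℝ) ^ a * ∫ x : PhaseSpace N, Real.exp (-((pinnedChain ω₂ lam β γ).hamiltonian N x) / T)
      ≤ max C 0 * (N : ℝ) ^ a * ∫ x : PhaseSpace N, Real.exp (-((pinnedChain ω₂ lam β γ).hamiltonian N x) / T) :=
        mul_le_mul_of_nonneg_right (mul_le_mul_of_nonneg_right (le_max_left _ _) hNa) hZ
    _ ≤ max C 0 * (N : ℝ) ^ b * ∫ x : PhaseSpace N, Real.exp (-((pinnedChain ω₂ lam β γ).hamiltonian N x) / T) :=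
        mul_le_mul_of_nonneg_right (mul_le_mul_of_nonneg_left hNab (le_max_right _ _)) hZ

/-! ## The graded response bound -/

/-- **`CCB(a)` ⟹ `D ≤ S·N^{(a−1)/2}`.**  Under weak-NESS uniqueness, along every steady-state family, for every `T > 0` there is `S ≥ 0` with
`D ≤ S·N^{(a−1)/2}` for every `N ≥ 2` and every response coefficient `D` of the `N`-chain at `T`: Green–Kubo in corrector form (PROVED
`CorrectorTheory`), AM–GM with the weight `θ = N^{(1−a)/2}`, `CCB(a)` and the statics `‖J_tot‖² ≤ C_J N Z` give
`(N−1)T²D ≤ (C₁+C_J)·N^{(a−1)/2}·N/2 ≤ (C₁+C_J)(N−1)N^{(a−1)/2}`. [folklore] -/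
theorem response_le_rpow_of_currentCorrectorBudget {a : ℝ} (hE : CurrentCorrectorBudget a) {ω₂ lam β γ : ℝ}
    (hω : 0 < ω₂) (hl : 0 < lam) (hβ : 0 < β) (hγ : 0 < γ)
    (huniq : ∀ (N : ℕ) (T_L T_R : ℝ), 0 < T_L → 0 < T_R → ∀ μ ν : Measure (PhaseSpace N),
      (pinnedChain ω₂ lam β γ).IsSteadyState N T_L T_R μ → (pinnedChain ω₂ lam β γ).IsSteadyState N T_L T_R ν →
        μ = ν)
    (μ : (N : ℕ) → ℝ → ℝ → Measure (PhaseSpace N))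
    (hμ : ∀ (N : ℕ) (T_L T_R : ℝ), 0 < T_L → 0 < T_R →
      (pinnedChain ω₂ lam β γ).IsSteadyState N T_L T_R (μ N T_L T_R))
    {T : ℝ} (hT : 0 < T) :
    ∃ S : ℝ, 0 ≤ S ∧ ∀ (N : ℕ) (D : ℝ), 2 ≤ N →
      Tendsto (fun δ : ℝ => (pinnedChain ω₂ lam β γ).totalCurrent (μ N (T + δ / 2) (T - δ / 2)) / δ)
        (𝓝[≠] 0) (𝓝 D) → D ≤ S * (N : ℝ) ^ ((a - 1) / 2) := by
  obtain ⟨C₁, hE1N⟩ := hE ω₂ lam β γ hω hl hβ hγ T hT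
  obtain ⟨CJ, hCJ0, hJ⟩ := exists_totalCurrent_sq_le hω hl.le hβ.le γ hT
  have hCT :=
    Summit.AtomisticToContinuum.FouriersLaw.Theorems.OddSectorIrreversibility.Corrector.CorrectorTheory_proof
  have hT2 : 0 < T ^ 2 := by positivity
  set C₁' : ℝ := max C₁ 1 with hC₁'def
  have hC₁'1 : 1 ≤ C₁' := le_max_right _ _
  have hC₁'0 : 0 < C₁' := lt_of_lt_of_le one_pos hC₁'1
  refine ⟨(C₁' + CJ) / T ^ 2, by positivity, fun N D hN2 hD => ?_⟩
  have hNpos : 0 < N := by omega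
  set P := pinnedChain ω₂ lam β γ with hP
  set n : ℝ := (N : ℝ) with hndef
  have hn2 : (2 : ℝ) ≤ n := by rw [hndef]; exact_mod_cast hN2
  have hn1 : 0 < n - 1 := by linarith
  have hn0 : 0 < n := by linarith
  have hn0' : n ≠ 0 := hn0.ne'
  -- the `N`-dependent AM–GM weight `θ = 1/M`, `M = n^{(a-1)/2}`, with `n^a = M²·n`
  set M : ℝ := n ^ ((a - 1) / 2) with hMdef
  have hM : 0 < M := Real.rpow_pos_of_pos hn0 _
  have hM2 : M ^ 2 = n ^ (a - 1) := by
    rw [hMdef, ← Real.rpow_two, ← Real.rpow_mul hn0.le]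
    congr 1
    ring
  have hna : n ^ a = M ^ 2 * n := by
    rw [hM2, Real.rpow_sub_one hn0' a, div_mul_cancel₀ _ hn0']
  set θ : ℝ := 1 / M with hθdef
  have hθ : 0 < θ := by positivity
  -- the corrector at `N` (CorrectorTheory A) and the Green–Kubo identity (CorrectorTheory B)
  obtain ⟨u, hu1, hu2, hu3, hu4, h5, h6, h7⟩ := hCT.1 ω₂ lam β γ hω hl hβ hγ T hT N
  obtain ⟨hcI, hGKB⟩ := hCT.2 ω₂ lam β γ hω hl hβ hγ huniq μ hμ T hT N D hD
  simp only [] at hu1 hu2 hu3 hu4 h5 h6 h7 hcI hGKB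
  clear h5 h6 h7 hu1
  have hpair := Summit.AtomisticToContinuum.FouriersLaw.Theorems.pinnedChain_integral_corrector_mul_withDensity
    hω hl.le hβ hγ hNpos hT hu2 hu4 hcI
  set μT : Measure (PhaseSpace N) := volume.withDensity fun x : PhaseSpace N =>
    ENNReal.ofReal (Real.exp (-(P.hamiltonian N x) / T)) with hμT
  set Z : ℝ := ∫ x : PhaseSpace N, Real.exp (-(P.hamiltonian N x) / T) with hZdef
  set J : PhaseSpace N → ℝ := fun x => ∑ i : Fin N, P.bondCurrent N i x with hJdef
  have hZ : 0 < Z := integral_exp_pos (pinnedChain_integrable_gibbsDensity hω hl.le hβ.le γ N hT)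
  -- `⟨u, J⟩_{μ_T} = Z (N-1) T² D`
  have hGK : ∫ x, u x * J x ∂μT = Z * ((n - 1) * T ^ 2 * D) := by
    rw [hGKB]; exact hpair.2
  -- `CCB(a)` at this `N` and this `u`
  have hE1' : ∫ x, (u x) ^ 2 ∂μT ≤ C₁' * n ^ a * Z := by
    have h := hE1N N u
    refine (h hu3).2.trans ?_
    exact mul_le_mul_of_nonneg_right (mul_le_mul_of_nonneg_right
      ((le_max_left _ _).trans (max_le_max le_rfl zero_le_one)) (Real.rpow_nonneg hn0.le a)) hZ.le
  -- the static bound at this `N`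
  have hJ' : ∫ x, (J x) ^ 2 ∂μT ≤ CJ * n * Z := hJ N
  -- integrability of the three integrands
  have huJ : Integrable (fun x => u x * J x) μT := hpair.1
  have hu2i : Integrable (fun x => (u x) ^ 2) μT := hu2.integrable_sq
  have hJ2i : Integrable (fun x => (J x) ^ 2) μT := by
    have hsm := Summit.AtomisticToContinuum.FouriersLaw.Theorems.pinnedChain_withDensity_eq_smul_gibbsMeasure
      (γ := γ) (N := N) hω hl.le hT hβ.le
    have hZt : P.partitionFunction N T ≠ ⊤ :=
      P.partitionFunction_ne_top (pinnedChain_integrable_gibbsDensity hω hl.le hβ.le γ N hT)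
    have hπ := (Summit.AtomisticToContinuum.FouriersLaw.Theorems.pinnedChain_sq_act_sum_bondCurrent
      hω hl.le hβ hγ hNpos hT 0).1
    rw [hμT, hsm]
    exact hπ.smul_measure hZt
  -- AM–GM under the integral
  have hamgm : ∫ x, u x * J x ∂μT ≤ θ / 2 * ∫ x, (u x) ^ 2 ∂μT + 1 / (2 * θ) * ∫ x, (J x) ^ 2 ∂μT := by
    have hgi : Integrable (fun x => θ / 2 * (u x) ^ 2 + 1 / (2 * θ) * (J x) ^ 2) μT :=
      (hu2i.const_mul (θ / 2)).add (hJ2i.const_mul (1 / (2 * θ)))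
    have hmono : ∫ x, u x * J x ∂μT ≤ ∫ x, (θ / 2 * (u x) ^ 2 + 1 / (2 * θ) * (J x) ^ 2) ∂μT :=
      integral_mono huJ hgi fun x => mul_le_weighted_amgm hθ (u x) (J x)
    have hsum : ∫ x, (θ / 2 * (u x) ^ 2 + 1 / (2 * θ) * (J x) ^ 2) ∂μT =
        θ / 2 * ∫ x, (u x) ^ 2 ∂μT + 1 / (2 * θ) * ∫ x, (J x) ^ 2 ∂μT := by
      rw [integral_add (hu2i.const_mul _) (hJ2i.const_mul _), integral_const_mul, integral_const_mul]
    exact hmono.trans_eq hsum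
  -- combine and divide by `Z`
  have hmain : (n - 1) * T ^ 2 * D ≤ θ / 2 * (C₁' * n ^ a) + 1 / (2 * θ) * (CJ * n) := by
    have h1 : Z * ((n - 1) * T ^ 2 * D) ≤ Z * (θ / 2 * (C₁' * n ^ a) + 1 / (2 * θ) * (CJ * n)) := by
      calc Z * ((n - 1) * T ^ 2 * D) = ∫ x, u x * J x ∂μT := hGK.symm
        _ ≤ θ / 2 * ∫ x, (u x) ^ 2 ∂μT + 1 / (2 * θ) * ∫ x, (J x) ^ 2 ∂μT := hamgm
        _ ≤ θ / 2 * (C₁' * n ^ a * Z) + 1 / (2 * θ) * (CJ * n * Z) := by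
            gcongr
        _ = Z * (θ / 2 * (C₁' * n ^ a) + 1 / (2 * θ) * (CJ * n)) := by ring
    exact le_of_mul_le_mul_left h1 hZ
  -- arithmetic with `θ = 1/M`, `n^a = M²n`: both terms are multiples of `M·n`
  have hM0 : M ≠ 0 := hM.ne'
  have hterm1 : θ / 2 * (C₁' * n ^ a) = C₁' * M * n / 2 := by
    rw [hna, hθdef]
    field_simp
  have hterm2 : 1 / (2 * θ) * (CJ * n) = CJ * M * n / 2 := by
    rw [hθdef]
    field_simp
  have hfin : (n - 1) * T ^ 2 * D ≤ (n - 1) * T ^ 2 * ((C₁' + CJ) / T ^ 2 * M) := by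
    have hK : 0 ≤ (C₁' + CJ) * M := by positivity
    calc (n - 1) * T ^ 2 * D ≤ θ / 2 * (C₁' * n ^ a) + 1 / (2 * θ) * (CJ * n) := hmain
      _ = (C₁' + CJ) * M * n / 2 := by rw [hterm1, hterm2]; ring
      _ ≤ (C₁' + CJ) * M * (n - 1) := by nlinarith [hK, hn2]
      _ = (n - 1) * T ^ 2 * ((C₁' + CJ) / T ^ 2 * M) := by
          field_simp
  have hpos : 0 < (n - 1) * T ^ 2 := by positivity
  exact le_of_mul_le_mul_left hfin hpos

/-! ## Escape-floor currency: `CCB(a) ⟹ F((3 − a)/2)` -/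

/-- Real arithmetic: `(n−1)γe ≤ S·n^r` with `n ≥ 2`, `γ > 0`, `S ≥ 0` gives `e ≤ (2S/γ)/n^{1−r}` (`n ≤ 2(n−1)`, `n^{1−r} = n/n^r`). [folklore] -/
theorem escapeFloor_of_response_le_rpow {n γ S r e : ℝ} (hn : 2 ≤ n) (hγ : 0 < γ) (hS : 0 ≤ S)
    (h : (n - 1) * γ * e ≤ S * n ^ r) : e ≤ 2 * S / γ / n ^ (1 - r) := by
  have hn0 : 0 < n := by linarith
  have hnr : 0 < n ^ r := Real.rpow_pos_of_pos hn0 r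
  have h1r : n ^ (1 - r) = n / n ^ r := by rw [Real.rpow_sub hn0, Real.rpow_one]
  have hR : 2 * S / γ / n ^ (1 - r) = 2 * S * n ^ r / (γ * n) := by
    rw [h1r]
    field_simp
  rw [hR, le_div_iff₀ (by positivity)]
  rcases le_or_gt 0 e with he | he
  · have hge : 0 ≤ γ * e := by positivity
    nlinarith [h, hge, hn]
  · have : e * (γ * n) < 0 := mul_neg_of_neg_of_pos he (by positivity)
    have : 0 ≤ 2 * S * n ^ r := by positivity
    linarith

/-- **`CurrentCorrectorBudget a → ExponentFloor ((3 − a)/2)`** — every rung of the escape ladder is fed by the corrector budget of exponent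
`a = 3 − 2s`.  Along the canonical steady-state family (existence + choice) the proved response identity makes `(N−1)γE_N` the response
coefficient; `response_le_rpow_of_currentCorrectorBudget` bounds it by `S·N^{(a−1)/2}`; `escapeFloor_of_response_le_rpow`. [folklore] -/
theorem exponentFloor_of_currentCorrectorBudget {a : ℝ} (hE : CurrentCorrectorBudget a) : ExponentFloor ((3 - a) / 2) := by
  intro ω₂ lam β γ hω hl hβ hγ T hT
  classical
  have huniq := bondHeatUncertainty_nessUnique_holds ω₂ lam β γ hω hl hβ hγ
  -- the canonical steady-state family
  let μ₀ : (N : ℕ) → ℝ → ℝ → MeasureTheory.Measure (PhaseSpace N) := fun N T_L T_R =>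
    if h : 0 < T_L ∧ 0 < T_R then
      Classical.choose (pinnedChain_exists_isSteadyState hω hl hβ hγ N h.1 h.2) else 0
  have hμ₀ : ∀ (N : ℕ) (T_L T_R : ℝ), 0 < T_L → 0 < T_R →
      (pinnedChain ω₂ lam β γ).IsSteadyState N T_L T_R (μ₀ N T_L T_R) := by
    intro N T_L T_R hL' hR'
    simp only [μ₀, dif_pos (And.intro hL' hR')]
    exact Classical.choose_spec (pinnedChain_exists_isSteadyState hω hl hβ hγ N hL' hR')
  have hRI := boundaryEscapeDeficit_responseIdentity_holds ω₂ lam β γ hω hl hβ hγ huniq μ₀ hμ₀ T hT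
  dsimp only at hRI
  obtain ⟨S, hS0, hS⟩ := response_le_rpow_of_currentCorrectorBudget hE hω hl hβ hγ huniq μ₀ hμ₀ hT
  refine ⟨2 * S / γ, 2, fun N hN => ?_⟩
  have hNpos : 0 < N := by omega
  have hn2 : (2 : ℝ) ≤ N := by exact_mod_cast hN
  have hDN := hS N (((N : ℝ) - 1) * γ * escapeDeficit ω₂ lam β γ T N) hN (hRI N hNpos).2
  have h13 : (3 - a) / 2 = 1 - (a - 1) / 2 := by ring
  rw [h13]
  exact escapeFloor_of_response_le_rpow hn2 hγ hS0 hDN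

/-- `CCB(2) ⟹ F(1/2)` (= file (7b)'s `halfOhmicFloor_of_coneScaleCorrector`, through the grading). [frame] -/
theorem halfOhmicFloor_of_currentCorrectorBudget_two (hE : CurrentCorrectorBudget 2) : HalfOhmicFloor := by
  have h := exponentFloor_of_currentCorrectorBudget hE
  norm_num at h
  exact h

/-- **`CCB(1) ⟹ 11071` outright** (`F(1) ⟺ BoundedResponse`). [kernel · frame] -/
theorem boundedResponse_of_currentCorrectorBudget_one (hE : CurrentCorrectorBudget 1) : BoundedResponse := by
  have h := exponentFloor_of_currentCorrectorBudget hE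
  norm_num at h
  exact exponentFloor_one_iff_boundedResponse.1 h

/-- `CCB(a) ⟹ 11071` for every `0 < a ≤ 1` (monotonicity to `a = 1`). [frame] -/
theorem boundedResponse_of_currentCorrectorBudget_of_le_one {a : ℝ} (ha0 : 0 < a) (ha1 : a ≤ 1)
    (hE : CurrentCorrectorBudget a) : BoundedResponse :=
  boundedResponse_of_currentCorrectorBudget_one (currentCorrectorBudget_mono ha0 ha1 hE)

/-- **Bigraded pairing: `SplitLaw θ ∧ CCB(a) ⟹ 11071` whenever `2θ + a < 3`** (`1 ≤ a ≤ 3`; tree kernel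
`boundedResponse_of_splitLaw_of_exponentFloor` at `s = (3 − a)/2`). [kernel · frame] -/
theorem boundedResponse_of_splitLaw_of_currentCorrectorBudget {θ a : ℝ} (ha1 : 1 ≤ a) (ha3 : a ≤ 3)
    (hθ : θ < (3 - a) / 2) (hS : JunctionDefectGrading.SplitLaw θ) (hE : CurrentCorrectorBudget a) : BoundedResponse :=
  JunctionDefectGrading.boundedResponse_of_splitLaw_of_exponentFloor hθ (by linarith) (by linarith) hS
    (exponentFloor_of_currentCorrectorBudget hE)

/-- **Buffered junction law + `CCB(a)`, any `1 ≤ a < 3` ⟹ 11071.** [kernel · frame] -/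
theorem boundedResponse_of_bufferedJunctionLaw_of_currentCorrectorBudget {a : ℝ} (ha1 : 1 ≤ a) (ha3 : a < 3)
    (hB : JunctionDefectGrading.BufferedJunctionLaw) (hE : CurrentCorrectorBudget a) : BoundedResponse :=
  JunctionDefectGrading.boundedResponse_of_bufferedJunctionLaw_of_exponentFloor (s := (3 - a) / 2) (by linarith) (by linarith) hB
    (exponentFloor_of_currentCorrectorBudget hE)

/-- **THE GRADED NODE: `LocalityPassivityLaw → CurrentCorrectorBudget a → BoundedResponse` for EVERY `1 ≤ a < 3`** — under junction
locality + buffer passivity the corrector budget need only beat the phonon exponent `3` (for `0 < a ≤ 1` no law is needed at all,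
`boundedResponse_of_currentCorrectorBudget_of_le_one`). [kernel · frame] -/
theorem boundedResponse_of_localityPassivityLaw_of_currentCorrectorBudget {a : ℝ} (ha1 : 1 ≤ a) (ha3 : a < 3)
    (hL : JunctionDefectGrading.LocalityPassivityLaw) (hE : CurrentCorrectorBudget a) : BoundedResponse :=
  JunctionDefectGrading.boundedResponse_of_localityPassivityLaw_of_exponentFloor (s := (3 - a) / 2) (by linarith) (by linarith) hL
    (exponentFloor_of_currentCorrectorBudget hE)

/-- `CCB(a)` + the bootstrap at `s = (3 − a)/2` ⟹ 11071. [kernel · frame] -/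
theorem boundedResponse_of_currentCorrectorBudget_of_bootstrap {a : ℝ} (hE : CurrentCorrectorBudget a)
    (hB : ExponentBootstrap ((3 - a) / 2)) : BoundedResponse :=
  boundedResponse_of_floor_bootstrap _ (exponentFloor_of_currentCorrectorBudget hE) hB

end EscapeGrading

end Summit.AtomisticToContinuum.FouriersLaw.Theorems.SubdiffusiveBondHeat

end
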